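import Summits.AtomisticToContinuum.Crystallization.Theses.PoissonBesselStacking
import Summits.AtomisticToContinuum.Crystallization.Theses.OneCrossingRisingSea
import Summits.AtomisticToContinuum.Crystallization.Theorems.PricedLinkCensusStackingHingeLjRegistryDomination
import Summits.AtomisticToContinuum.Crystallization.Theorems.PricedLinkCensusStackingHingeBarlowEnergyIdentification
import Summits.AtomisticToContinuum.Crystallization.Theorems.PricedLinkCensusStackingHingeHcpEnergyMinOnBox
import Summits.AtomisticToContinuum.Crystallization.Theorems.MinMeanCycleStackingLockHaggEnergyPeriodic

/-!
# Birth skeleton — crux `PoissonBesselStacking.HcpPeriodicMinimiser`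

Item `stmt-AtomisticToContinuum-3061` (auto-crux, formerly the target `X_E` of route
`PoissonBesselStacking`; shared verbatim with `SymmetryRankLadder` (crux), `LuttingerTiszaRegistry`,
`ChessboardParticlePlanes`, `HcpDefectCounting` (support)).

The crux: some relaxed HCP stacking `hcpPeriodicConfiguration ha hh` with `(a, h)` in the box
`B = {47/50 ≤ a ≤ 1, 39/50·a ≤ h ≤ 17/20·a}` is a LEAST element of the Lennard-Jones energy per
particle over ALL periodic configurations of `ℝ³`.

## The cut (two named stubs, both existing ledger items stated VERBATIM; registered on this crux)

* `stub_periodicReductionToBarlow` — (R) the genuinely three-dimensional content, verbatim the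
  shared crux `PoissonBesselStacking.PeriodicReductionToBarlow` (item stmt-AtomisticToContinuum-3062,
  with its own registered lines `Cruxes/PeriodicReductionToBarlow/Lines/{birth,layered_seam}.lean`):
  every periodic `Q` is matched, at no higher Lennard-Jones energy per particle, by a UNIFORM Barlow
  stacking `barlowPeriodicConfiguration s ha hh hp hs` with `(a, h) ∈ B` and `s` a `p`-periodic Hägg
  word. Open; XL (Blanc–Lewin 2015 §2.3: periodic layering of near-optimal `Q` + hole locking +
  spacing convexity).
* `stub_dominatedRegistrySelectsHcp` — (S) the one-dimensional, infinite-volume STACKING SELECTION,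
  verbatim the support item `OneCrossingRisingSea.DominatedRegistrySelectsHcp`
  (item stmt-AtomisticToContinuum-12054): for any coupling sequence `J` with `Σ k|J_k| < ∞` and
  `J₂ + Σ_{k≥3}(k−1)|J_k| ≤ 0`, the alternating Hägg word (hcp, ABAB…) minimises the stacking energy
  density `haggStackingEnergy J` over all Hägg words. Provable now (Peierls/defect count: the
  finite-volume core is the landed `HaggDominationAllRanges`, item 0737, then divide by `n`, `liminf`);
  S–M.

## Assembly `HcpPeriodicMinimiser_of` (sorry-free; concludes the route decl BY NAME)

Its two hypotheses are the two stub statements, written BY NAME as the ledger items they are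
(`PoissonBesselStacking.PeriodicReductionToBarlow`, `OneCrossingRisingSea.DominatedRegistrySelectsHcp`
— definitionally the stub signatures; the `example` after it re-checks the literal shape
`<stub₁ signature> → <stub₂ signature> → HcpPeriodicMinimiser`). Proof: take the box minimiser
`(a₀, h₀)` of the relaxed-hcp energy (LANDED item 3066,
`PricedHcpWindowsHcpBox.stub_hcpEnergyMinOnBox`); `e(hcp a₀ h₀)` is in the range by `rfl`; for a
competitor `Q`, (R) gives `(a, h) ∈ B` and a `p`-periodic Hägg `s` with `e(barlow a h s) ≤ e(Q)`; the
LANDED certified numerics (item 3063, `PricedHcpWindowsLjRegistry.stub_ljRegistryDomination`) give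
at `(a, h)` the summability and the domination hypothesis of (S) for `J = barlowCoupling lennardJones a h`
(`J₂ < 0`, `Σ_{k≥3}(k−1)|J_k| ≤ |J₂|/2`); (S) gives `h(J, alt) ≤ h(J, s)`, where
`h(J, alt) = Σ'_{k even ≥ 2} J_k` (`haggStackingEnergy_alternating`) and `h(J, s) = H_p(J, s)/p` for the
`p`-periodic `s` (LANDED periodic averaging `Theorems.tendsto_haggEnergy_div`, the proof of item 12022);
the LANDED layer identification (item 3065, `PricedHcpWindowsBarlowEnergy.stub_barlowEnergyIdentification`)
gives `e(barlow a h s) = e₀(a, h) + H_p/p` and `PricedHcpWindowsHcpBox.energyPerParticle_hcp_eq` gives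
`e(hcp a h) = e₀(a, h) + Σ'_{even} J_k`; chain `e(hcp a₀ h₀) ≤ e(hcp a h) ≤ e(barlow a h s) ≤ e(Q)`.

Sorries: exactly the two stubs (`lean check --json`: rc 0, errors 0, sorries 2;
`HcpPeriodicMinimiser_of` axioms `[propext, Classical.choice, Quot.sound]`). Stub (R) is a CONSEQUENCE
of the crux (take `Q ↦` the hcp minimiser itself, `s` alternating, `p = 2`); stub (S) is not (general
`J`). Neither is the crux or the sub-problem `Crystallization` reworded: the BC3 probes
`stub → HcpPeriodicMinimiser`, `stub → Crystallization` by `first | exact? | simpa | aesop` all fail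
(folder `bc/`, NOTES.md). Disproof used: none on file for this crux (no `Disproof.lean`); negatives
index: no refuted statement of `AtomisticToContinuum` is an instance of either stub. The same term
closes the four shared copies of the item (`SymmetryRankLadder`/`LuttingerTiszaRegistry`/
`ChessboardParticlePlanes`/`HcpDefectCounting.HcpPeriodicMinimiser`) by definitional unfolding
(checked in the folder, not re-imported here to keep this file's imports minimal).
-/

namespace Summit.AtomisticToContinuum.Crystallization.Cruxes.HcpPeriodicMinimiser.Birth

/-- **Stub (R) — reduction of the periodic problem to uniform Barlow stackings in the box**
(verbatim the shared crux `PoissonBesselStacking.PeriodicReductionToBarlow`, item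
stmt-AtomisticToContinuum-3062): for every periodic configuration `Q` of `ℝ³` there are
`(a, h) ∈ B` and a `p`-periodic Hägg word `s` such that the uniform Barlow stacking
`barlowPeriodicConfiguration s ha hh hp hs` has Lennard-Jones energy per particle `≤` that of `Q`.
Open (Blanc–Lewin 2015 §2.3); XL. -/
theorem stub_periodicReductionToBarlow : ∀ Q : Literature.MathematicalPhysics.StatisticalMechanics.PeriodicConfiguration 3, ∃ a h : ℝ, 47 / 50 ≤ a ∧ a ≤ 1 ∧ 39 / 50 * a ≤ h ∧ h ≤ 17 / 20 * a ∧ ∃ (s : ℤ → ℤ) (p : ℕ) (ha : a ≠ 0) (hh : h ≠ 0) (hp : p ≠ 0) (hs : ∀ i, s (i + p) = s i), Literature.MathematicalPhysics.StatisticalMechanics.IsHaggSeq s ∧ (Literature.MathematicalPhysics.StatisticalMechanics.barlowPeriodicConfiguration s ha hh hp hs).energyPerParticle Literature.MathematicalPhysics.StatisticalMechanics.lennardJones ≤ Q.energyPerParticle Literature.MathematicalPhysics.StatisticalMechanics.lennardJones := by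
  sorry

/-- **Stub (S) — dominated registry couplings select hcp** (verbatim the support item
`OneCrossingRisingSea.DominatedRegistrySelectsHcp`, item stmt-AtomisticToContinuum-12054): for every
coupling sequence `J` with `Σ k|J_k| < ∞` and `J₂ + Σ_{k≥3}(k−1)|J_k| ≤ 0`, the alternating Hägg word
minimises `haggStackingEnergy J` over all Hägg words. Provable now (finite-volume core = the landed
`HaggDominationAllRanges`, item 0737; divide by `n`, `liminf`, `haggStackingEnergy_alternating`); S–M. -/
theorem stub_dominatedRegistrySelectsHcp : ∀ J : ℕ → ℝ, Summable (fun k : ℕ => (k : ℝ) * |J k|) → J 2 + ∑' k : ℕ, (if 3 ≤ k then ((k : ℝ) - 1) * |J k| else 0) ≤ 0 → IsLeast (Set.range fun s : {s : ℤ → ℤ // Literature.MathematicalPhysics.StatisticalMechanics.IsHaggSeq s} => Literature.MathematicalPhysics.StatisticalMechanics.haggStackingEnergy J s.1) (Literature.MathematicalPhysics.StatisticalMechanics.haggStackingEnergy J Literature.MathematicalPhysics.StatisticalMechanics.alternatingHagg) := by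
  sorry

open Literature.MathematicalPhysics.StatisticalMechanics in
/-- **Assembly**: stub (R) → stub (S) → the crux — the two hypotheses are the stub statements BY
NAME (items 3062 and 12054), composed with the LANDED items 3066 (box minimiser of the relaxed-hcp
energy), 3063 (sign + domination of the LJ registry couplings on the box), 3065 (layer
identification of the energy of a periodic Barlow stacking) and the landed periodic averaging of the
Hägg energy. Concludes `PoissonBesselStacking.HcpPeriodicMinimiser` by name; no `sorry`. -/
theorem HcpPeriodicMinimiser_of :
    Summit.AtomisticToContinuum.Crystallization.Theses.PoissonBesselStacking.PeriodicReductionToBarlow →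
    Summit.AtomisticToContinuum.Crystallization.Theses.OneCrossingRisingSea.DominatedRegistrySelectsHcp →
    Summit.AtomisticToContinuum.Crystallization.Theses.PoissonBesselStacking.HcpPeriodicMinimiser := by
  intro hR hS
  -- (M, landed item 3066): the box minimiser (a₀, h₀) of the relaxed-hcp energy
  obtain ⟨a₀, h₀, ha₀, hh₀, hb₁, hb₂, hb₃, hb₄, hmin⟩ :=
    Summit.AtomisticToContinuum.Crystallization.Theorems.PricedHcpWindowsHcpBox.stub_hcpEnergyMinOnBox
  refine ⟨a₀, h₀, ha₀, hh₀, hb₁, hb₂, hb₃, hb₄, ⟨hcpPeriodicConfiguration ha₀ hh₀, rfl⟩, ?_⟩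
  rintro _ ⟨Q, rfl⟩
  -- (R, stub = item 3062): a uniform Barlow competitor with parameters in the box below Q
  obtain ⟨a, h, hc₁, hc₂, hc₃, hc₄, s, p, ha, hh, hp, hs, hHagg, hle⟩ := hR Q
  have ha0 : 0 < a := by linarith
  have hh0 : 0 < h := by nlinarith
  have hp_pos : 0 < p := Nat.pos_of_ne_zero hp
  -- (D, landed item 3063): summability, J₂ < 0 and the half-domination of the LJ couplings at (a, h)
  obtain ⟨hsum, hJ2, htail⟩ :=
    Summit.AtomisticToContinuum.Crystallization.Theorems.PricedHcpWindowsLjRegistry.stub_ljRegistryDomination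
      a h hc₁ hc₂ hc₃ hc₄
  have hdomJ : barlowCoupling lennardJones a h 2 +
      ∑' k : ℕ, (if 3 ≤ k then ((k : ℝ) - 1) * |barlowCoupling lennardJones a h k| else 0) ≤ 0 := by
    have habs : |barlowCoupling lennardJones a h 2| = -barlowCoupling lennardJones a h 2 := abs_of_neg hJ2
    linarith
  -- (S, stub = item 12054): the alternating (hcp) word minimises the stacking energy density
  have hsel : haggStackingEnergy (barlowCoupling lennardJones a h) alternatingHagg ≤
      haggStackingEnergy (barlowCoupling lennardJones a h) s :=
    (hS (barlowCoupling lennardJones a h) hsum hdomJ).2 ⟨⟨s, hHagg⟩, rfl⟩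
  -- h(J, alt) = Σ'_{even} J_k (`haggStackingEnergy_alternating`); h(J, s) = H_p/p for p-periodic s
  -- (landed periodic averaging `Theorems.tendsto_haggEnergy_div`, the proof of item 12022)
  have hper : haggStackingEnergy (barlowCoupling lennardJones a h) s =
      haggEnergy p (barlowCoupling lennardJones a h) s / p := by
    unfold haggStackingEnergy
    exact (Summit.AtomisticToContinuum.Crystallization.Theorems.tendsto_haggEnergy_div hs _ hp_pos).liminf_eq
  have hdiv : (∑' k : ℕ, (if 2 ≤ k ∧ Even k then barlowCoupling lennardJones a h k else 0)) ≤
      haggEnergy p (barlowCoupling lennardJones a h) s / p :=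
    calc (∑' k : ℕ, (if 2 ≤ k ∧ Even k then barlowCoupling lennardJones a h k else 0))
          = haggStackingEnergy (barlowCoupling lennardJones a h) alternatingHagg :=
            (haggStackingEnergy_alternating _).symm
      _ ≤ haggStackingEnergy (barlowCoupling lennardJones a h) s := hsel
      _ = haggEnergy p (barlowCoupling lennardJones a h) s / p := hper
  -- (E, landed item 3065): layer identification of the competitor, and the hcp closed form
  have hEbar :=
    Summit.AtomisticToContinuum.Crystallization.Theorems.PricedHcpWindowsBarlowEnergy.stub_barlowEnergyIdentification
      a h ha0 hh0 s p ha hh hp hs hHagg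
  have hEhcp :=
    Summit.AtomisticToContinuum.Crystallization.Theorems.PricedHcpWindowsHcpBox.energyPerParticle_hcp_eq
      ha0 hh0 ha hh
  -- chain: e(hcp a₀ h₀) ≤ e(hcp a h) = e₀ + Σ'_{even} J_k ≤ e₀ + H_p/p = e(barlow a h s) ≤ e(Q)
  calc (hcpPeriodicConfiguration ha₀ hh₀).energyPerParticle lennardJones
        ≤ (hcpPeriodicConfiguration ha hh).energyPerParticle lennardJones := hmin a h ha hh hc₁ hc₂ hc₃ hc₄
    _ = barlowBaseEnergy lennardJones a h +
          ∑' k : ℕ, (if 2 ≤ k ∧ Even k then barlowCoupling lennardJones a h k else 0) := hEhcp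
    _ ≤ barlowBaseEnergy lennardJones a h + haggEnergy p (barlowCoupling lennardJones a h) s / p := by
          linarith
    _ = (barlowPeriodicConfiguration s ha hh hp hs).energyPerParticle lennardJones := hEbar.symm
    _ ≤ Q.energyPerParticle lennardJones := hle

/-- The assembly instantiated with the two stubs: the crux, modulo exactly the two `sorry`s. -/
theorem HcpPeriodicMinimiser_skeleton : Summit.AtomisticToContinuum.Crystallization.Theses.PoissonBesselStacking.HcpPeriodicMinimiser :=
  HcpPeriodicMinimiser_of stub_periodicReductionToBarlow stub_dominatedRegistrySelectsHcp

/- Literal BC3 shape, kernel-checked: `HcpPeriodicMinimiser_of` has (definitionally) the type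
`<signature of stub_periodicReductionToBarlow> → <signature of stub_dominatedRegistrySelectsHcp> →
HcpPeriodicMinimiser`. -/
example : (∀ Q : Literature.MathematicalPhysics.StatisticalMechanics.PeriodicConfiguration 3, ∃ a h : ℝ, 47 / 50 ≤ a ∧ a ≤ 1 ∧ 39 / 50 * a ≤ h ∧ h ≤ 17 / 20 * a ∧ ∃ (s : ℤ → ℤ) (p : ℕ) (ha : a ≠ 0) (hh : h ≠ 0) (hp : p ≠ 0) (hs : ∀ i, s (i + p) = s i), Literature.MathematicalPhysics.StatisticalMechanics.IsHaggSeq s ∧ (Literature.MathematicalPhysics.StatisticalMechanics.barlowPeriodicConfiguration s ha hh hp hs).energyPerParticle Literature.MathematicalPhysics.StatisticalMechanics.lennardJones ≤ Q.energyPerParticle Literature.MathematicalPhysics.StatisticalMechanics.lennardJones) → (∀ J : ℕ → ℝ, Summable (fun k : ℕ => (k : ℝ) * |J k|) → J 2 + ∑' k : ℕ, (if 3 ≤ k then ((k : ℝ) - 1) * |J k| else 0) ≤ 0 → IsLeast (Set.range fun s : {s : ℤ → ℤ // Literature.MathematicalPhysics.StatisticalMechanics.IsHaggSeq s} => Literature.MathematicalPhysics.StatisticalMechanics.haggStackingEnergy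 J s.1) (Literature.MathematicalPhysics.StatisticalMechanics.haggStackingEnergy J Literature.MathematicalPhysics.StatisticalMechanics.alternatingHagg)) → Summit.AtomisticToContinuum.Crystallization.Theses.PoissonBesselStacking.HcpPeriodicMinimiser :=
  HcpPeriodicMinimiser_of

end Summit.AtomisticToContinuum.Crystallization.Cruxes.HcpPeriodicMinimiser.Birth
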